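import Mathlib.RepresentationTheory.Intertwining
import HarnessLib

/-!
# Two semilinear bijections out of one module differ by a LINEAR isomorphism

Topic `RepresentationTheory/Semisimple`; namespace `Literature.RepresentationTheory.Semisimple`.  THEOREMS ONLY (no definition, no named
fact, no instance); Mathlib only.

For a SURJECTIVE ring homomorphism `σ : R →+* S` (e.g. an automorphism `σ ∈ Aut(ℂ)`) and two `σ`-semilinear BIJECTIONS `f : V → W`, `g : V → W'`
out of the same `R`-module `V`, the composite `g ∘ f⁻¹ : W → W'` is `S`-LINEAR (`g(f⁻¹(σ(r)·w)) = g(r·f⁻¹w) = σ(r)·g(f⁻¹ w)`), hence an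
`S`-linear isomorphism `W ≃ₗ[S] W'` (`exists_linearEquiv_of_semilinear_pair`); if `f` and `g` intertwine actions of a group (monoid, set) `G`, so does
`g ∘ f⁻¹` (`exists_linearEquiv_equivariant_of_semilinear_pair`, `nonempty_equiv_of_semilinear_pair`).  In the language of twists: two
`σ`-semilinear isomorphisms `V^{[σ]} ≅ W`, `V^{[σ]} ≅ W'` give `W ≅ W'` LINEARLY — the bookkeeping step by which a Galois-twist computation
(`ω^{[σ]} ≅ ω'`) is fed into a LINEAR rigidity statement ([Liu2021, App. D Lem. D.1 (3)] in the cell hodgecm-mathlib's road to Thm. 4.18 (3), row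
III-11: at each place `v`, [Flath restriction of the global `σ`-isomorphism] and [local twist identity] are two `σ`-semilinear bijections out of
the same local type).  Standard semilinear algebra ([Bourbaki, *Algèbre* II §1 no. 13 «applications semi-linéaires»]).
HC_CM is proved only modulo the 7 printed citations until rung 0 closes; this file discharges none of them.

## References
* [BourbakiAlgebraI1989] N. Bourbaki, *Algebra I, Chapters 1–3* (Springer 1989), Ch. II §1 no. 13 (semi-linear maps; composition of a `σ`- and a `σ⁻¹`-semilinear map is linear).
* [Liu2021] Y. Liu, Camb. J. Math. 9 (2021), Thm. 4.18 (3) proof (l. 2272–2289), App. D Lem. D.1 (3).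
-/

namespace Literature.RepresentationTheory.Semisimple

section Module

variable {R S : Type*} [Semiring R] [Semiring S] {σ : R →+* S} [RingHomSurjective σ]
variable {V W W' : Type*} [AddCommMonoid V] [AddCommMonoid W] [AddCommMonoid W'] [Module R V] [Module S W] [Module S W']

omit [RingHomSurjective σ] in
/-- The set-theoretic inverse of a bijective `σ`-semilinear map is additive. [cite: BourbakiAlgebraI1989, Ch. II §1 no. 13] -/
theorem ofBijective_symm_add (f : V →ₛₗ[σ] W) (hf : Function.Bijective f) (w₁ w₂ : W) :
    (Equiv.ofBijective f hf).symm (w₁ + w₂) = (Equiv.ofBijective f hf).symm w₁ + (Equiv.ofBijective f hf).symm w₂ :=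
  hf.1 (by simp only [map_add f, Equiv.ofBijective_apply_symm_apply])

omit [RingHomSurjective σ] in
/-- The set-theoretic inverse of a bijective `σ`-semilinear map is `σ⁻¹`-semilinear: `f⁻¹ (σ(r)·w) = r·f⁻¹(w)`.
[cite: BourbakiAlgebraI1989, Ch. II §1 no. 13] -/
theorem ofBijective_symm_smul (f : V →ₛₗ[σ] W) (hf : Function.Bijective f) (r : R) (w : W) :
    (Equiv.ofBijective f hf).symm (σ r • w) = r • (Equiv.ofBijective f hf).symm w :=
  hf.1 (by simp only [map_smulₛₗ f, Equiv.ofBijective_apply_symm_apply])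

/-- **Two `σ`-semilinear bijections out of one module differ by a linear isomorphism**: for `σ : R →+* S` surjective and bijective
`σ`-semilinear `f : V → W`, `g : V → W'` there is an `S`-linear isomorphism `h : W ≃ₗ[S] W'` with `h ∘ f = g` (namely `g ∘ f⁻¹`).
[cite: BourbakiAlgebraI1989, Ch. II §1 no. 13] -/
theorem exists_linearEquiv_of_semilinear_pair (f : V →ₛₗ[σ] W) (g : V →ₛₗ[σ] W') (hf : Function.Bijective f)
    (hg : Function.Bijective g) : ∃ h : W ≃ₗ[S] W', ∀ v, h (f v) = g v := by
  let ef := Equiv.ofBijective f hf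
  let h₀ : W →ₗ[S] W' :=
    { toFun := fun w => g (ef.symm w)
      map_add' := fun w₁ w₂ => by
        simp only [ef]
        rw [ofBijective_symm_add, map_add]
      map_smul' := fun s w => by
        obtain ⟨r, rfl⟩ := (RingHomSurjective.is_surjective : Function.Surjective σ) s
        simp only [ef, RingHom.id_apply]
        rw [ofBijective_symm_smul, map_smulₛₗ] }
  have hbij : Function.Bijective h₀ := hg.comp ef.symm.bijective
  refine ⟨LinearEquiv.ofBijective h₀ hbij, fun v => ?_⟩
  change g (ef.symm (f v)) = g v
  simp only [ef, Equiv.ofBijective_symm_apply_apply]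

omit [RingHomSurjective σ] in
/-- … and `h` is unique on the nose: any such `h` is `w ↦ g (f⁻¹ w)`. [cite: BourbakiAlgebraI1989, Ch. II §1 no. 13] -/
theorem linearEquiv_apply_eq_of_comp_eq (f : V →ₛₗ[σ] W) (g : V →ₛₗ[σ] W') (hf : Function.Bijective f)
    (h : W ≃ₗ[S] W') (hh : ∀ v, h (f v) = g v) (w : W) : h w = g ((Equiv.ofBijective f hf).symm w) := by
  conv_lhs => rw [← Equiv.ofBijective_apply_symm_apply f hf w]
  exact hh _

/-- **Equivariant version**: if `f : V → W` and `g : V → W'` (bijective, `σ`-semilinear, `σ` surjective) intertwine actions `ρ_V`, `ρ_W`, `ρ_{W'}`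
of a type `G` (`f (ρ_V x v) = ρ_W x (f v)`, `g (ρ_V x v) = ρ_{W'} x (g v)`), then the linear isomorphism `h = g ∘ f⁻¹ : W ≃ₗ[S] W'` intertwines
`ρ_W` and `ρ_{W'}`. [cite: BourbakiAlgebraI1989, Ch. II §1 no. 13] -/
theorem exists_linearEquiv_equivariant_of_semilinear_pair {G : Type*} (ρV : G → V → V) (ρW : G → W → W) (ρW' : G → W' → W')
    (f : V →ₛₗ[σ] W) (g : V →ₛₗ[σ] W') (hf : Function.Bijective f) (hg : Function.Bijective g)
    (hfe : ∀ x v, f (ρV x v) = ρW x (f v)) (hge : ∀ x v, g (ρV x v) = ρW' x (g v)) :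
    ∃ h : W ≃ₗ[S] W', (∀ v, h (f v) = g v) ∧ ∀ x w, h (ρW x w) = ρW' x (h w) := by
  obtain ⟨h, hh⟩ := exists_linearEquiv_of_semilinear_pair f g hf hg
  refine ⟨h, hh, fun x w => ?_⟩
  obtain ⟨v, rfl⟩ := hf.2 w
  rw [← hfe, hh, hh, hge]

/-- The same with the roles of `W`, `W'` displayed symmetrically: a linear isomorphism `W' ≃ₗ[S] W` intertwining `ρ_{W'}` and `ρ_W` with
`h' ∘ g = f`. [cite: BourbakiAlgebraI1989, Ch. II §1 no. 13] -/
theorem exists_linearEquiv_equivariant_of_semilinear_pair' {G : Type*} (ρV : G → V → V) (ρW : G → W → W) (ρW' : G → W' → W')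
    (f : V →ₛₗ[σ] W) (g : V →ₛₗ[σ] W') (hf : Function.Bijective f) (hg : Function.Bijective g)
    (hfe : ∀ x v, f (ρV x v) = ρW x (f v)) (hge : ∀ x v, g (ρV x v) = ρW' x (g v)) :
    ∃ h' : W' ≃ₗ[S] W, (∀ v, h' (g v) = f v) ∧ ∀ x w', h' (ρW' x w') = ρW x (h' w') :=
  exists_linearEquiv_equivariant_of_semilinear_pair ρV ρW' ρW g f hg hf hge hfe

end Module

section Representation

variable {R S : Type*} [Semiring R] [CommSemiring S] {σ : R →+* S} [RingHomSurjective σ]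
variable {V W W' : Type*} [AddCommMonoid V] [AddCommMonoid W] [AddCommMonoid W'] [Module R V] [Module S W] [Module S W']
variable {G : Type*} [Monoid G]

/-- **Representation form**: two bijective `σ`-semilinear maps `f : V → W`, `g : V → W'` intertwining an action `ρ_V` of `G` on `V` with
`S`-linear representations `ρ_W`, `ρ_{W'}` yield an EQUIVALENCE OF REPRESENTATIONS `ρ_W ≃ ρ_{W'}` (Mathlib `Representation.Equiv`) — the form
consumed by linear rigidity statements such as [Liu2021, App. D Lem. D.1 (3)] read on a family (`Nonempty (ρ.Equiv ρ')`).
[cite: BourbakiAlgebraI1989, Ch. II §1 no. 13] [cite: Liu2021, Thm. 4.18 (3) proof (l. 2272–2289)] -/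
theorem nonempty_equiv_of_semilinear_pair (ρV : G → V → V) (ρW : Representation S G W) (ρW' : Representation S G W')
    (f : V →ₛₗ[σ] W) (g : V →ₛₗ[σ] W') (hf : Function.Bijective f) (hg : Function.Bijective g)
    (hfe : ∀ x v, f (ρV x v) = ρW x (f v)) (hge : ∀ x v, g (ρV x v) = ρW' x (g v)) :
    Nonempty (ρW.Equiv ρW') := by
  obtain ⟨h, -, he⟩ := exists_linearEquiv_equivariant_of_semilinear_pair ρV (fun x w => ρW x w) (fun x w => ρW' x w) f g hf hg hfe hge
  exact ⟨Representation.Equiv.mk h fun x => LinearMap.ext fun w => he x w⟩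

/-- The same from the `∃ f, Bijective f ∧ …` shape in which `σ`-semilinear isomorphisms are typed in the cell (row III-11
`Thm418Data.EpsRigidUnderGaloisTwist`, `exists_semilinear_localTypes_of_semilinear`). [cite: BourbakiAlgebraI1989, Ch. II §1 no. 13] [cite: Liu2021, Thm. 4.18 (3) proof (l. 2272–2289)] -/
theorem nonempty_equiv_of_exists_semilinear_pair (ρV : G → V → V) (ρW : Representation S G W) (ρW' : Representation S G W')
    (hf : ∃ f : V →ₛₗ[σ] W, Function.Bijective f ∧ ∀ x v, f (ρV x v) = ρW x (f v))
    (hg : ∃ g : V →ₛₗ[σ] W', Function.Bijective g ∧ ∀ x v, g (ρV x v) = ρW' x (g v)) :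
    Nonempty (ρW.Equiv ρW') := by
  obtain ⟨f, hf, hfe⟩ := hf
  obtain ⟨g, hg, hge⟩ := hg
  exact nonempty_equiv_of_semilinear_pair ρV ρW ρW' f g hf hg hfe hge

/-- The linear-equivalence reading (`∃ h : W ≃ₗ[S] W', ∀ x w, h (ρ_W x w) = ρ_{W'} x (h w)`, the `AreIsomorphic` shape of
`Liu2021.Thm418Data`). [cite: BourbakiAlgebraI1989, Ch. II §1 no. 13] [cite: Liu2021, Thm. 4.18 (2), (3)] -/
theorem exists_linearEquiv_equivariant_of_exists_semilinear_pair (ρV : G → V → V) (ρW : Representation S G W)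
    (ρW' : Representation S G W')
    (hf : ∃ f : V →ₛₗ[σ] W, Function.Bijective f ∧ ∀ x v, f (ρV x v) = ρW x (f v))
    (hg : ∃ g : V →ₛₗ[σ] W', Function.Bijective g ∧ ∀ x v, g (ρV x v) = ρW' x (g v)) :
    ∃ h : W ≃ₗ[S] W', ∀ x w, h (ρW x w) = ρW' x (h w) := by
  obtain ⟨f, hf, hfe⟩ := hf
  obtain ⟨g, hg, hge⟩ := hg
  obtain ⟨h, -, he⟩ := exists_linearEquiv_equivariant_of_semilinear_pair ρV (fun x w => ρW x w) (fun x w => ρW' x w) f g hf hg hfe hge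
  exact ⟨h, he⟩

end Representation

end Literature.RepresentationTheory.Semisimple
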